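import Literature.IUT.HodgeArakelov.BadPrimeGaussianMonoidsCor36GenuineRecordFamily

/-!
# [IUTchII] Cor 3.6 (ii) «↷» at the genuine `θ_env` data for ANY inversion family, with PRINT'S constant monoid
# `O := 𝒪^▷_{ℚ̄_p} ≤ ℚ̄_pˣ` through `ε` — every model-data input discharged (proof-only sequel of `…Cor36GenuineRecordFamily`)

S. Mochizuki, *Inter-universal Teichmüller theory II*, kurims Dec-2020 manuscript, Cor 3.6 (ii) p. 100 l. 23–26 and the `∞`-row,
Cor 3.5 (ii) p. 95 (bracket), Prop 3.1 (ii) p. 88 («naturally isomorphic to `𝒪^▷_{F̄_v}`»), Rmk 1.4.1 (ii) p. 28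
[cite: Mochizuki2012, Cor 3.6 (ii) p.100]; [cite: MochizukiAbsTopIII2015, Definition 3.1 (i) p.66] (`𝒪^▷_{k̄}`). Claim key
DISPUTED (D-0012); nothing disputed is asserted here. PROOF-ONLY companion (abc-iut cell, layer L6, seat abc-iut-w5-d192 gen 4;
node **IUTchII:Cor3.6(ii)** «↷», sub-DAG row Cor-36.ii.r9, row COR36-GENUINE-FAMILY). NO definition, NO `Prop` fact, NO instance.

WHAT IS PROVED — the two print's-`O` corollaries of this lineage (`cor36ii_psi_thetaEnvRecordKummer_nonzeroIntegers_of_mem_thetaEnv`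
p431165, `cor36ii_infty_thetaEnvRecordKummer_nonzeroIntegers_of_cyclotomeTower_rigid` p431816), re-stated for the FAMILY record
`(thetaEnvData …).toRecord (h1LimConjMulAut …) (h1LimKummerOn c … 𝒪^▷) iota` with an ARBITRARY family `iota` of inversion actions
(print's OUTER `ι_Ÿ`; the v1 record used the conjugates of an INNER `ι₀`, degenerate per abc-iut-w4-d019's v2 note):
* **`cor36ii_psi_toRecord_family_nonzeroIntegers_of_mem_thetaEnv`** — `Ψ`-level, exact, `hO`/`hq` DISCHARGED (`q := ε`:
  abc-iut-w5-d192 `smul_eq_self_of_aug_eq_one`, `smul_mem_comap_nonzeroIntegers_padic`); inputs = the evaluation-sections DATA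
  (`s_t` continuous into `Π^tp_{Ÿ̲̲}`, common `φ₀`, sections of `ε` up to one identification `w : Π₀ → G_{ℚ_p}`, restrictions pinned),
  `θ ∈ θ^{i₀}_env(𝕄_*)`, the coefficient datum `c`;
* **`cor36ii_infty_toRecord_family_nonzeroIntegers_of_cyclotomeTower_rigid`** — `∞`-level up to a family of ROOTS OF UNITY, with
  `(c, hc)` PRODUCED from the chain tower (`exists_cyclotomeCoefficients_mods`, p429119; inputs `IsEtThOrigin` F-2498 and
  `IsCompact Δ_Θ` G-w5d187-1 BY NAME), `hOtors`, `hOroot`, `hO`, `hq`, `hlim` DISCHARGED; residual input = print's root condition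
  `hroots` (a theorem of the Prop 2.2 (ii)′ datum, abc-iut-w4-d004 p427094 / this lineage p427541 / p430246).
HONEST FRAMING: composition of landed theorems; no side taken on [IUTchIII] Cor 3.12; typed ≠ proved ≠ endorsed.
-/

noncomputable section

namespace Literature.IUT.HodgeArakelov

namespace EtaleLevels

open Literature.AnabelianGeometry.EtaleTheta CohomologySystemOfContH1 EtaleThetaDataOfSetting TemperedThetaMonoids
  BadPrimeGaussianMonoids Literature.AnabelianGeometry.AbsoluteAnabelian

variable {p : ℕ} [Fact p.Prime] {D : Literature.AnabelianGeometry.EtaleTheta.ThetaSetting p}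
  {E : D.EtaleThetaData} {l : ℕ} (C : E.DoubleUnderline l) (hC : D.Compat) (hS : D.Sec2Hyps)
  (hl : l.Prime) (hp2 : p ≠ 2) (hpl : p ≠ l) (hζ : ∃ ζ : D.K, IsPrimitiveRoot ζ (4 * l))
  (mods : ∀ M : ℕ+, D.CyclotomeMod l M)
  (f : contCocycles D.toTheta D.DeltaTheta C.GtpYdduu) (hf : f ∈ C.rootCocycles hC)
  (hmods : ∀ (M M' : ℕ+) (h : (M : ℕ) ∣ (M' : ℕ)) (x : D.lDeltaTheta l),
    MuN.red p M M' h ((mods M').red x) = (mods M).red x)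
  (h15 : Literature.AnabelianGeometry.EtaleTheta.ThetaSetting.Prop15iii E hC) (L : C.CuspLabels)
  (hZ : ∀ M : ℕ+, Nonempty (ModelCyclotomes.lDeltaQuot (C.rigidData (mods M) hC hS h15 L) ≃*
    Literature.IUT.HodgeTheaters.ZHat))
  (hcharY : EtaleThetaDataOfSetting.PiYddCharacteristic C)
  (hlim : Function.Bijective (rigidLimHom C hC hS hl hp2 hpl hζ mods f hf hmods h15 L hZ))
  [(EtaleThetaDataOfSetting.PiYdd C).Normal]
  (c : CyclotomeCoefficients (phi C) (D.lDeltaTheta l) (PadicAlgCl p)ˣ)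
  {Iota : Type}
  (iota : Iota → ((thetaEnvData C hC hS hl hp2 hpl hζ mods f hf hmods h15 L hZ hcharY hlim).D.coh.lim ≃+
    (thetaEnvData C hC hS hl hp2 hpl hζ mods f hf hmods h15 L hZ hcharY hlim).D.coh.lim))
  {Lbl : Type*} {P₀ : TopGroup.{0}} (φ₀ : P₀ →* D.GtpTheta) (s : Lbl → (P₀ →* Pi C))
  (hι : ∀ t, Continuous ((MonoidHom.id (Pi C)).comp (s t)))
  (hN : ∀ t, (⊤ : Subgroup P₀).map ((MonoidHom.id (Pi C)).comp (s t)) ≤ PiYdd C)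
  (hφ : ∀ t, (phi C).comp ((MonoidHom.id (Pi C)).comp (s t)) = φ₀)

/-- **[IUTchII] Cor 3.6 (ii) «↷», `Ψ`-LEVEL, at the genuine `θ_env` data with ANY inversion family `iota` and print's constant
monoid `O := 𝒪^▷_{ℚ̄_p} ≤ ℚ̄_pˣ` through `ε`** (`hO`, `hq` DISCHARGED; `q := ε`): for every family of continuous evaluation sections
`s_t : Π₀ → Π^tp_{X̲̲}` landing in `Π^tp_{Ÿ̲̲}`, with common coefficient action `φ₀`, that are sections of `ε` up to one identification
`w : Π₀ → G_{ℚ_p}` (`ε ∘ s_t = w`), every `θ ∈ θ^{i₀}_env(𝕄_*)` and every tuple `x : Lbl → 𝒪^▷_{ℚ̄_p}` whose labeled Kummer classes lie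
in `Ψ_ξ(θ)`: the translated tuple `(s_t(g) · x_t)_t` has its labeled Kummer classes in `Ψ_ξ(θ)` again.
[claim: Mochizuki2012, status: disputed] (IUTchII §3 Cor 3.6 (ii), kurims p.100) -/
theorem cor36ii_psi_toRecord_family_nonzeroIntegers_of_mem_thetaEnv
    (w : P₀ →* Literature.AnabelianGeometry.SemiGraphs.GQp p)
    (hsec : ∀ t g, aug C (s t g) = w g) {i₀ : Iota}
    {θ : ((thetaEnvData C hC hS hl hp2 hpl hζ mods f hf hmods h15 L hZ hcharY hlim).toRecord
          (h1LimConjMulAut (phi C) (D.lDeltaTheta l) (PiYdd C)) (h1LimKummerOn (phi C) (D.lDeltaTheta l) (PiYdd C) c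
            (isOpen_stabilizer_units C) (finiteIndex_stabilizer_units C) ((nonzeroIntegers ℚ_[p] (PadicAlgCl p)).comap (Units.coeHom (PadicAlgCl p))))
          iota).H}
    (hθ : θ ∈ ((thetaEnvData C hC hS hl hp2 hpl hζ mods f hf hmods h15 L hZ hcharY hlim).toRecord
          (h1LimConjMulAut (phi C) (D.lDeltaTheta l) (PiYdd C)) (h1LimKummerOn (phi C) (D.lDeltaTheta l) (PiYdd C) c
            (isOpen_stabilizer_units C) (finiteIndex_stabilizer_units C) ((nonzeroIntegers ℚ_[p] (PadicAlgCl p)).comap (Units.coeHom (PadicAlgCl p))))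
          iota).thetaEnv i₀)
    (R : Lbl → (((thetaEnvData C hC hS hl hp2 hpl hζ mods f hf hmods h15 L hZ hcharY hlim).toRecord
          (h1LimConjMulAut (phi C) (D.lDeltaTheta l) (PiYdd C)) (h1LimKummerOn (phi C) (D.lDeltaTheta l) (PiYdd C) c
            (isOpen_stabilizer_units C) (finiteIndex_stabilizer_units C) ((nonzeroIntegers ℚ_[p] (PadicAlgCl p)).comap (Units.coeHom (PadicAlgCl p))))
          iota).H →*
      Multiplicative (h1Lim φ₀ (D.lDeltaTheta l) (⊤ : Subgroup P₀) ⊥)))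
    (hR : ∀ t y, Multiplicative.toAdd (R t y) =
      h1LimCongr (D.lDeltaTheta l) ⊤ (hφ t) ⊥
        (h1LimComap (phi C) (D.lDeltaTheta l) ((MonoidHom.id (Pi C)).comp (s t)) (hι t) (hN t)
          (AddEquiv.additiveMultiplicative (h1Lim (phi C) (D.lDeltaTheta l) (PiYdd C) ⊥) (Additive.ofMul y))))
    (t₀ : Lbl) (g : P₀) {x : Lbl → ((nonzeroIntegers ℚ_[p] (PadicAlgCl p)).comap (Units.coeHom (PadicAlgCl p)))}
    (hx : (fun t => R t (h1LimKummerOn (phi C) (D.lDeltaTheta l) (PiYdd C) c (isOpen_stabilizer_units C)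
        (finiteIndex_stabilizer_units C) ((nonzeroIntegers ℚ_[p] (PadicAlgCl p)).comap (Units.coeHom (PadicAlgCl p))) (x t))) ∈
      MonoidHom.mrange (MonoidHom.pi fun t => (R t).comp (splitMonoid
        ((thetaEnvData C hC hS hl hp2 hpl hζ mods f hf hmods h15 L hZ hcharY hlim).toRecord
          (h1LimConjMulAut (phi C) (D.lDeltaTheta l) (PiYdd C)) (h1LimKummerOn (phi C) (D.lDeltaTheta l) (PiYdd C) c
            (isOpen_stabilizer_units C) (finiteIndex_stabilizer_units C) ((nonzeroIntegers ℚ_[p] (PadicAlgCl p)).comap (Units.coeHom (PadicAlgCl p))))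
          iota).units (Submonoid.powers θ)).subtype)) :
    (fun t => R t (h1LimKummerOn (phi C) (D.lDeltaTheta l) (PiYdd C) c (isOpen_stabilizer_units C)
        (finiteIndex_stabilizer_units C) ((nonzeroIntegers ℚ_[p] (PadicAlgCl p)).comap (Units.coeHom (PadicAlgCl p)))
        ⟨(s t g) • ((x t : ((nonzeroIntegers ℚ_[p] (PadicAlgCl p)).comap (Units.coeHom (PadicAlgCl p)))) : (PadicAlgCl p)ˣ),
          smul_mem_comap_nonzeroIntegers_padic C (s t g) (x t).2⟩)) ∈
      MonoidHom.mrange (MonoidHom.pi fun t => (R t).comp (splitMonoid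
        ((thetaEnvData C hC hS hl hp2 hpl hζ mods f hf hmods h15 L hZ hcharY hlim).toRecord
          (h1LimConjMulAut (phi C) (D.lDeltaTheta l) (PiYdd C)) (h1LimKummerOn (phi C) (D.lDeltaTheta l) (PiYdd C) c
            (isOpen_stabilizer_units C) (finiteIndex_stabilizer_units C) ((nonzeroIntegers ℚ_[p] (PadicAlgCl p)).comap (Units.coeHom (PadicAlgCl p))))
          iota).units (Submonoid.powers θ)).subtype) :=
  cor36ii_psi_toRecord_family_of_mem_thetaEnv C hC hS hl hp2 hpl hζ mods f hf hmods h15 L hZ hcharY hlim c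
    (isOpen_stabilizer_units C) (finiteIndex_stabilizer_units C)
    ((nonzeroIntegers ℚ_[p] (PadicAlgCl p)).comap (Units.coeHom (PadicAlgCl p)))
    (fun σ _ hb => smul_mem_comap_nonzeroIntegers_padic C σ hb) iota φ₀ s hι hN hφ (aug C)
    (fun _ hy a _ => smul_eq_self_of_aug_eq_one C hy a) w hsec hθ R hR t₀ g hx

/-- **[IUTchII] Cor 3.6 (ii) «↷», `∞`-LEVEL UP TO TORSION, at the genuine `θ_env` data with ANY inversion family and PRINT'S constant
monoid `O := 𝒪^▷_{ℚ̄_p} ≤ ℚ̄_pˣ` through `ε`, every model-data input DISCHARGED** (`(c, hc)` from the chain tower, `hOtors`, `hOroot`,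
`hO`, `hq := ε`, `hlim`): there is a bijective coefficient datum `c`, pinned by the level formula `(mods M).red (c ζ) = ζ_M`, such that
for every inversion family `iota`, every `θ ∈ θ^{i₀}_env(𝕄_*)`, every label `i` with print's root condition `hroots` relative to `θ`,
every family of continuous evaluation sections `s_t` landing in `Π^tp_{Ÿ̲̲}` with common `φ₀` that are sections of `ε` up to one
identification `w`, and every tuple `y : Lbl → 𝒪^▷_{ℚ̄_p}` whose labeled Kummer classes lie in `∏ R_t(∞Ψ^{i}_env)`, the translate
`(s_t(g) · y_t)_t` lies there again up to a family of ROOTS OF UNITY. [claim: Mochizuki2012, status: disputed]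
(IUTchII §3 Cor 3.6 (ii), kurims p.100) -/
theorem cor36ii_infty_toRecord_family_nonzeroIntegers_of_cyclotomeTower_rigid (hO' : D.IsEtThOrigin)
    (hΔ : IsCompact (D.DeltaTheta : Set D.GtpTheta)) (w : P₀ →* Literature.AnabelianGeometry.SemiGraphs.GQp p)
    (hsec : ∀ t g, aug C (s t g) = w g) :
    ∃ c : CyclotomeCoefficients (phi C) (D.lDeltaTheta l) (PadicAlgCl p)ˣ,
      Function.Bijective c.hom ∧
      (∀ (ζ : Literature.AnabelianGeometry.EtaleTheta.cyclotome (PadicAlgCl p)ˣ) (M : ℕ+),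
        (((mods M).red (c.hom ζ) : MuN p M) : (PadicAlgCl p)ˣ) = (ζ : ℕ+ → (PadicAlgCl p)ˣ) M) ∧
      ∀ {Iota : Type}
        (iota : Iota → ((thetaEnvData C hC hS hl hp2 hpl hζ mods f hf hmods h15 L hZ hcharY (bijective_rigidLimHom C hC hS hl hp2 hpl hζ mods f hf hmods h15 L hZ)).D.coh.lim ≃+
          (thetaEnvData C hC hS hl hp2 hpl hζ mods f hf hmods h15 L hZ hcharY (bijective_rigidLimHom C hC hS hl hp2 hpl hζ mods f hf hmods h15 L hZ)).D.coh.lim))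
        {i₀ : Iota}
        {θ : ((thetaEnvData C hC hS hl hp2 hpl hζ mods f hf hmods h15 L hZ hcharY (bijective_rigidLimHom C hC hS hl hp2 hpl hζ mods f hf hmods h15 L hZ)).toRecord
          (h1LimConjMulAut (phi C) (D.lDeltaTheta l) (PiYdd C)) (h1LimKummerOn (phi C) (D.lDeltaTheta l) (PiYdd C) c
            (isOpen_stabilizer_units C) (finiteIndex_stabilizer_units C) ((nonzeroIntegers ℚ_[p] (PadicAlgCl p)).comap (Units.coeHom (PadicAlgCl p))))
          iota).H},
        θ ∈ ((thetaEnvData C hC hS hl hp2 hpl hζ mods f hf hmods h15 L hZ hcharY (bijective_rigidLimHom C hC hS hl hp2 hpl hζ mods f hf hmods h15 L hZ)).toRecord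
          (h1LimConjMulAut (phi C) (D.lDeltaTheta l) (PiYdd C)) (h1LimKummerOn (phi C) (D.lDeltaTheta l) (PiYdd C) c
            (isOpen_stabilizer_units C) (finiteIndex_stabilizer_units C) ((nonzeroIntegers ℚ_[p] (PadicAlgCl p)).comap (Units.coeHom (PadicAlgCl p))))
          iota).thetaEnv i₀ →
        ∀ (i : ((thetaEnvData C hC hS hl hp2 hpl hζ mods f hf hmods h15 L hZ hcharY (bijective_rigidLimHom C hC hS hl hp2 hpl hζ mods f hf hmods h15 L hZ)).toRecord
          (h1LimConjMulAut (phi C) (D.lDeltaTheta l) (PiYdd C)) (h1LimKummerOn (phi C) (D.lDeltaTheta l) (PiYdd C) c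
            (isOpen_stabilizer_units C) (finiteIndex_stabilizer_units C) ((nonzeroIntegers ℚ_[p] (PadicAlgCl p)).comap (Units.coeHom (PadicAlgCl p))))
          iota).Iota),
        (∀ ϑ ∈ ((thetaEnvData C hC hS hl hp2 hpl hζ mods f hf hmods h15 L hZ hcharY (bijective_rigidLimHom C hC hS hl hp2 hpl hζ mods f hf hmods h15 L hZ)).toRecord
          (h1LimConjMulAut (phi C) (D.lDeltaTheta l) (PiYdd C)) (h1LimKummerOn (phi C) (D.lDeltaTheta l) (PiYdd C) c
            (isOpen_stabilizer_units C) (finiteIndex_stabilizer_units C) ((nonzeroIntegers ℚ_[p] (PadicAlgCl p)).comap (Units.coeHom (PadicAlgCl p))))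
          iota).inftyThetaEnv i,
          ∃ n : ℕ, 0 < n ∧ ϑ ^ n ∈
            splitMonoid ((thetaEnvData C hC hS hl hp2 hpl hζ mods f hf hmods h15 L hZ hcharY (bijective_rigidLimHom C hC hS hl hp2 hpl hζ mods f hf hmods h15 L hZ)).toRecord
          (h1LimConjMulAut (phi C) (D.lDeltaTheta l) (PiYdd C)) (h1LimKummerOn (phi C) (D.lDeltaTheta l) (PiYdd C) c
            (isOpen_stabilizer_units C) (finiteIndex_stabilizer_units C) ((nonzeroIntegers ℚ_[p] (PadicAlgCl p)).comap (Units.coeHom (PadicAlgCl p))))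
          iota).units (Submonoid.powers θ)) →
        ∀ (R : Lbl → (((thetaEnvData C hC hS hl hp2 hpl hζ mods f hf hmods h15 L hZ hcharY (bijective_rigidLimHom C hC hS hl hp2 hpl hζ mods f hf hmods h15 L hZ)).toRecord
          (h1LimConjMulAut (phi C) (D.lDeltaTheta l) (PiYdd C)) (h1LimKummerOn (phi C) (D.lDeltaTheta l) (PiYdd C) c
            (isOpen_stabilizer_units C) (finiteIndex_stabilizer_units C) ((nonzeroIntegers ℚ_[p] (PadicAlgCl p)).comap (Units.coeHom (PadicAlgCl p))))
          iota).H →* Multiplicative (h1Lim φ₀ (D.lDeltaTheta l) (⊤ : Subgroup P₀) ⊥))),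
          (∀ t y, Multiplicative.toAdd (R t y) =
            h1LimCongr (D.lDeltaTheta l) ⊤ (hφ t) ⊥
              (h1LimComap (phi C) (D.lDeltaTheta l) ((MonoidHom.id (Pi C)).comp (s t)) (hι t) (hN t)
                (AddEquiv.additiveMultiplicative (h1Lim (phi C) (D.lDeltaTheta l) (PiYdd C) ⊥) (Additive.ofMul y)))) →
          ∀ (t₀ : Lbl) (g : P₀) {y : Lbl → ((nonzeroIntegers ℚ_[p] (PadicAlgCl p)).comap (Units.coeHom (PadicAlgCl p)))},
            (fun t => R t (h1LimKummerOn (phi C) (D.lDeltaTheta l) (PiYdd C) c (isOpen_stabilizer_units C)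
        (finiteIndex_stabilizer_units C) ((nonzeroIntegers ℚ_[p] (PadicAlgCl p)).comap (Units.coeHom (PadicAlgCl p))) (y t))) ∈
              (((thetaEnvData C hC hS hl hp2 hpl hζ mods f hf hmods h15 L hZ hcharY (bijective_rigidLimHom C hC hS hl hp2 hpl hζ mods f hf hmods h15 L hZ)).toRecord
          (h1LimConjMulAut (phi C) (D.lDeltaTheta l) (PiYdd C)) (h1LimKummerOn (phi C) (D.lDeltaTheta l) (PiYdd C) c
            (isOpen_stabilizer_units C) (finiteIndex_stabilizer_units C) ((nonzeroIntegers ℚ_[p] (PadicAlgCl p)).comap (Units.coeHom (PadicAlgCl p))))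
          iota).inftyThetaMonoid i).map (MonoidHom.pi R) →
            ∃ v : Lbl → ((nonzeroIntegers ℚ_[p] (PadicAlgCl p)).comap (Units.coeHom (PadicAlgCl p))),
              (∀ t, IsOfFinOrder (v t)) ∧
              (fun t => R t (h1LimKummerOn (phi C) (D.lDeltaTheta l) (PiYdd C) c (isOpen_stabilizer_units C)
        (finiteIndex_stabilizer_units C) ((nonzeroIntegers ℚ_[p] (PadicAlgCl p)).comap (Units.coeHom (PadicAlgCl p)))
                  (v t * ⟨(s t g) • ((y t : ((nonzeroIntegers ℚ_[p] (PadicAlgCl p)).comap (Units.coeHom (PadicAlgCl p)))) :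
                      (PadicAlgCl p)ˣ), smul_mem_comap_nonzeroIntegers_padic C (s t g) (y t).2⟩))) ∈
                (((thetaEnvData C hC hS hl hp2 hpl hζ mods f hf hmods h15 L hZ hcharY (bijective_rigidLimHom C hC hS hl hp2 hpl hζ mods f hf hmods h15 L hZ)).toRecord
          (h1LimConjMulAut (phi C) (D.lDeltaTheta l) (PiYdd C)) (h1LimKummerOn (phi C) (D.lDeltaTheta l) (PiYdd C) c
            (isOpen_stabilizer_units C) (finiteIndex_stabilizer_units C) ((nonzeroIntegers ℚ_[p] (PadicAlgCl p)).comap (Units.coeHom (PadicAlgCl p))))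
          iota).inftyThetaMonoid i).map (MonoidHom.pi R) := by
  obtain ⟨c, hc, hlev⟩ := exists_cyclotomeCoefficients_mods C mods hmods hO' hΔ
  refine ⟨c, hc, hlev, fun {Iota} iota {i₀} {θ} hθ i hroots R hR t₀ g y hy => ?_⟩
  exact cor36ii_infty_toRecord_family_of_mem_thetaEnv C hC hS hl hp2 hpl hζ mods f hf hmods h15 L hZ hcharY
    (bijective_rigidLimHom C hC hS hl hp2 hpl hζ mods f hf hmods h15 L hZ) c (isOpen_stabilizer_units C)
    (finiteIndex_stabilizer_units C) ((nonzeroIntegers ℚ_[p] (PadicAlgCl p)).comap (Units.coeHom (PadicAlgCl p)))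
    (fun σ _ hb => smul_mem_comap_nonzeroIntegers_padic C σ hb) iota φ₀ s hι hN hφ hc
    (fun a ha => ⟨mem_comap_nonzeroIntegers_padic_of_isOfFinOrder' ha,
      mem_comap_nonzeroIntegers_padic_of_isOfFinOrder' ha.inv⟩)
    (fun _ _ hn ha => mem_comap_nonzeroIntegers_of_pow_mem hn ha) (aug C)
    (fun _ hy' a _ => smul_eq_self_of_aug_eq_one C hy' a) w hsec hθ i hroots R hR t₀ g hy

end EtaleLevels

end Literature.IUT.HodgeArakelov

end
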